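import Summits.QuantumAdvantage.QuantumAdvantage.Theorems.LivenessSeparationLaw
import Summits.QuantumAdvantage.QuantumAdvantage.Theorems.LivenessSeparationLawC

set_option linter.dupNamespace false

/-!
# LIVENESS SEPARATION, part J (lens 4, g28 cycle 4c) — the CLASS NORMAL FORM: silencing dead registers and merging co-live ones on a set of inputs

Blocker `X = AbsorptionDial.NoPerfectPolyOdd` (item 28487); rungs `TwoQuadNoPerfectOdd` and «`t` quadratic registers, `t` constant» of the t-ladder
(NODE-g28 §5d–§5f).  Parts E (flat separation, `coLive_ends`) and G (merge law) used GLOBAL dead / co-live hypotheses; but the deletion identity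
`ringWinU_silence` and the merge law `ringWinU_merge` are POINTWISE in the input, so both moves only need their liveness hypothesis ON THE INPUTS ONE
PLAYS ON.  Kernel-checked here, for an arbitrary set of registers:

* `silenceSet`, `ringWinU_silenceSet` — silencing a set `S` of registers that are all DEAD at `u` leaves the win bit at `u` unchanged;
* `mergeSet`, `mergeSet_insert`, `ringWinU_mergeSet` — XOR-merging a set `S ∌ g₀` of registers, each live at `u` exactly when `g₀` is, into `g₀`
  (and silencing them) leaves the win bit at `u` unchanged;
* `liveCut_fill_block_outside` — on the sub-board of a flat BLOCK `[a, a+m)` (bits outside frozen), every cut OUTSIDE the block has a liveness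
  that depends only on `|v| mod 3`: on a residue class of the block every outside cut is constantly dead or constantly live, so ANY family of
  outside cuts splits into a dead part and a pairwise co-live part;
* ★ `winsOn_class_normalForm` — hence a PERFECT strategy, restricted to a residue class `|v| ≡ τ` of a flat block, has the same (all-true) win bits
  as its CLASS NORMAL FORM `mergeSet (silenceSet y Q_dead) g₀ Q_live`: for any set `Q` of cuts outside the block (the quadratic ones, say) the dead
  members are silenced and the live members are merged into one live member `g₀` — ONE exceptional register reading all the live quadratics, every
  other register unchanged; ★ `loss_of_class_normalForm_loss` — a loss of the normal form on the class is a loss of `y`.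
This is the common kernel lever behind T1 (one live quadratic cut on the class ⇒ (c0)_loc) and T2′ (two ⇒ (c0)₂), uniform in the number `t` of
quadratic cuts outside the block (NODE-g28 §5f: every CONSTANT rung of the t-ladder reduces on a block of dimension `≥ (n − t)/(t+1)` to (c0)_{t′},
`t′ ≤ t` live labels).  Bookkeeping only; no arithmetic beyond `mod 3`.
-/

open Finset
open Summit.QuantumAdvantage.AdviceFreeQNC0
open Summit.QuantumAdvantage.QuantumAdvantage.Theorems.InnerDegreeDial

namespace Summit.QuantumAdvantage.QuantumAdvantage.Theorems.LivenessSeparation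

variable {n : ℕ}

/-! ### silencing a set of dead registers -/

/-- silencing a register that is dead at `u` does not change the win bit at `u` (pointwise deletion identity) -/
theorem ringWinU_silence_of_dead (c : ℕ) (y : Fin (n + 1) → (Fin n → Bool) → Bool) (g : Fin (n + 1)) (u : Fin n → Bool)
    (hdead : liveCut c u g = false) : ringWinU c (silence y g) u = ringWinU c y u := by
  rw [ringWinU_silence c y g u, hdead, Bool.and_false, Bool.xor_false]

/-- silence every register of the set `S` -/
def silenceSet (y : Fin (n + 1) → (Fin n → Bool) → Bool) (S : Finset (Fin (n + 1))) : Fin (n + 1) → (Fin n → Bool) → Bool :=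
  fun g u => if g ∈ S then false else y g u

/-- nothing silenced -/
theorem silenceSet_empty (y : Fin (n + 1) → (Fin n → Bool) → Bool) : silenceSet y ∅ = y := by
  funext g u
  simp [silenceSet]

/-- one more register silenced -/
theorem silenceSet_insert (y : Fin (n + 1) → (Fin n → Bool) → Bool) (S : Finset (Fin (n + 1))) (g : Fin (n + 1)) :
    silenceSet y (insert g S) = silence (silenceSet y S) g := by
  funext g' u
  unfold silenceSet silence
  by_cases h : g' = g
  · subst h
    simp
  · rw [Function.update_of_ne h]
    simp [h]

/-- members are silenced -/
theorem silenceSet_of_mem (y : Fin (n + 1) → (Fin n → Bool) → Bool) {S : Finset (Fin (n + 1))} {g : Fin (n + 1)} (h : g ∈ S)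
    (u : Fin n → Bool) : silenceSet y S g u = false := by
  simp [silenceSet, h]

/-- non-members are unchanged -/
theorem silenceSet_of_not_mem (y : Fin (n + 1) → (Fin n → Bool) → Bool) {S : Finset (Fin (n + 1))} {g : Fin (n + 1)} (h : g ∉ S)
    (u : Fin n → Bool) : silenceSet y S g u = y g u := by
  simp [silenceSet, h]

/-- **silencing a set of registers that are all dead at `u` does not change the win bit at `u`** -/
theorem ringWinU_silenceSet (c : ℕ) (y : Fin (n + 1) → (Fin n → Bool) → Bool) (S : Finset (Fin (n + 1))) (u : Fin n → Bool)
    (hdead : ∀ g ∈ S, liveCut c u g = false) : ringWinU c (silenceSet y S) u = ringWinU c y u := by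
  classical
  induction S using Finset.induction_on with
  | empty => rw [silenceSet_empty]
  | insert g S hg ih =>
    rw [silenceSet_insert, ringWinU_silence_of_dead c _ g u (hdead g (mem_insert_self g S))]
    exact ih fun g' hg' => hdead g' (mem_insert_of_mem hg')

/-! ### merging a set of co-live registers into one -/

/-- merge the registers of `S` into `g₀`: `g₀` fires iff an odd number of `y g₀`, `y g` (`g ∈ S`) fire; the members of `S` are silenced -/
def mergeSet (y : Fin (n + 1) → (Fin n → Bool) → Bool) (g₀ : Fin (n + 1)) (S : Finset (Fin (n + 1))) :
    Fin (n + 1) → (Fin n → Bool) → Bool :=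
  fun g u => if g = g₀ then xor (y g₀ u) (decide ((S.filter fun g' => y g' u = true).card % 2 = 1))
    else if g ∈ S then false else y g u

/-- nothing merged -/
theorem mergeSet_empty (y : Fin (n + 1) → (Fin n → Bool) → Bool) (g₀ : Fin (n + 1)) : mergeSet y g₀ ∅ = y := by
  funext g u
  unfold mergeSet
  by_cases h : g = g₀
  · subst h
    simp
  · simp [h]

/-- the merged register -/
theorem mergeSet_self (y : Fin (n + 1) → (Fin n → Bool) → Bool) (g₀ : Fin (n + 1)) (S : Finset (Fin (n + 1))) (u : Fin n → Bool) :
    mergeSet y g₀ S g₀ u = xor (y g₀ u) (decide ((S.filter fun g' => y g' u = true).card % 2 = 1)) := by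
  simp [mergeSet]

/-- members other than `g₀` are silenced -/
theorem mergeSet_of_mem (y : Fin (n + 1) → (Fin n → Bool) → Bool) {g₀ g : Fin (n + 1)} {S : Finset (Fin (n + 1))} (h : g ∈ S)
    (h₀ : g ≠ g₀) (u : Fin n → Bool) : mergeSet y g₀ S g u = false := by
  simp [mergeSet, h, h₀]

/-- non-members other than `g₀` are unchanged -/
theorem mergeSet_of_not_mem (y : Fin (n + 1) → (Fin n → Bool) → Bool) {g₀ g : Fin (n + 1)} {S : Finset (Fin (n + 1))} (h : g ∉ S)
    (h₀ : g ≠ g₀) (u : Fin n → Bool) : mergeSet y g₀ S g u = y g u := by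
  simp [mergeSet, h, h₀]

/-- one more register merged = one binary merge (part G) of the partial merge -/
theorem mergeSet_insert (y : Fin (n + 1) → (Fin n → Bool) → Bool) {g₀ g : Fin (n + 1)} {S : Finset (Fin (n + 1))} (hg : g ∉ S)
    (h₀ : g ≠ g₀) : mergeSet y g₀ (insert g S) = merge (mergeSet y g₀ S) g₀ g := by
  classical
  funext g' u
  by_cases h' : g' = g₀
  · subst h'
    rw [merge_fst, mergeSet_self, mergeSet_self, mergeSet_of_not_mem y hg h₀ u, filter_insert]
    by_cases hy : y g u = true
    · rw [if_pos hy, card_insert_of_notMem (fun hm => hg (mem_of_mem_filter g hm)), hy]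
      rcases Nat.mod_two_eq_zero_or_one (S.filter fun g'' => y g'' u = true).card with h2 | h2
      · have h3 : ((S.filter fun g'' => y g'' u = true).card + 1) % 2 = 1 := by omega
        simp [h2, h3]
      · have h3 : ((S.filter fun g'' => y g'' u = true).card + 1) % 2 = 0 := by omega
        simp [h2, h3]
    · rw [if_neg hy]
      simp [hy]
  · by_cases h'' : g' = g
    · subst h''
      rw [mergeSet_of_mem y (mem_insert_self g' S) h₀ u, merge_snd _ (Ne.symm h₀)]
    · rw [merge_of_ne _ h' h'']
      by_cases hm : g' ∈ S
      · rw [mergeSet_of_mem y (mem_insert_of_mem hm) h' u, mergeSet_of_mem y hm h' u]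
      · rw [mergeSet_of_not_mem y (by simp [h'', hm]) h' u, mergeSet_of_not_mem y hm h' u]

/-- **merging a set of registers, each live at `u` exactly when `g₀` is, does not change the win bit at `u`** (pointwise; iterated part G) -/
theorem ringWinU_mergeSet (c : ℕ) (y : Fin (n + 1) → (Fin n → Bool) → Bool) (g₀ : Fin (n + 1)) (S : Finset (Fin (n + 1)))
    (hS : g₀ ∉ S) (u : Fin n → Bool) (hco : ∀ g ∈ S, liveCut c u g₀ = liveCut c u g) :
    ringWinU c (mergeSet y g₀ S) u = ringWinU c y u := by
  classical
  induction S using Finset.induction_on with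
  | empty => rw [mergeSet_empty]
  | insert g S hg ih =>
    have h₀ : g ≠ g₀ := fun h => hS (h ▸ mem_insert_self g S)
    rw [mergeSet_insert y hg h₀, ringWinU_merge c (mergeSet y g₀ S) (Ne.symm h₀) u (hco g (mem_insert_self g S))]
    exact ih (fun hm => hS (mem_insert_of_mem hm)) fun g' hg' => hco g' (mem_insert_of_mem hg')

/-- **loss transfer for the normal form `mergeSet (silenceSet y S_d) g₀ S_l` at one input:** if the registers of `S_d` are dead at `u` and those of
`S_l ∌ g₀` are live at `u` exactly when `g₀` is, the normal form has the same win bit at `u` as `y` -/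
theorem ringWinU_normalForm (c : ℕ) (y : Fin (n + 1) → (Fin n → Bool) → Bool) (g₀ : Fin (n + 1)) (Sd Sl : Finset (Fin (n + 1)))
    (hl : g₀ ∉ Sl) (u : Fin n → Bool) (hdead : ∀ g ∈ Sd, liveCut c u g = false) (hco : ∀ g ∈ Sl, liveCut c u g₀ = liveCut c u g) :
    ringWinU c (mergeSet (silenceSet y Sd) g₀ Sl) u = ringWinU c y u := by
  rw [ringWinU_mergeSet c _ g₀ Sl hl u hco, ringWinU_silenceSet c y Sd u hdead]

/-! ### flat blocks: outside cuts have constant liveness on a residue class -/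

/-- on the sub-board of the block `[a, a+m)` (outside bits frozen to `ρ`) the liveness of a cut OUTSIDE the block depends only on `|v| mod 3` -/
theorem liveCut_fill_block_outside {m : ℕ} (c : ℕ) (ρ : Fin n → Bool) (a : ℕ) (h : a + m ≤ n) (g : Fin (n + 1))
    (hg : g.val ≤ a ∨ a + m ≤ g.val) (v v' : Fin m → Bool)
    (hvv : (univ.filter fun j => v j = true).card % 3 = (univ.filter fun j => v' j = true).card % 3) :
    liveCut c (fill ρ (blockEmb a m h) v) g = liveCut c (fill ρ (blockEmb a m h) v') g := by
  unfold liveCut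
  rcases hg with hg | hg
  · rw [walkExp_fill_block_right ρ a h g.val hg v, walkExp_fill_block_right ρ a h g.val hg v']
    have : (c + g.val + (frozenExp ρ (blockEmb a m h) g.val + (univ.filter fun j => v j = true).card)) % 3
        = (c + g.val + (frozenExp ρ (blockEmb a m h) g.val + (univ.filter fun j => v' j = true).card)) % 3 := by omega
    rw [this]
  · rw [walkExp_fill_block_left ρ a h g.val hg v, walkExp_fill_block_left ρ a h g.val hg v']
    have : (c + g.val + (frozenExp ρ (blockEmb a m h) g.val + 2 * (univ.filter fun j => v j = true).card)) % 3
        = (c + g.val + (frozenExp ρ (blockEmb a m h) g.val + 2 * (univ.filter fun j => v' j = true).card)) % 3 := by omega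
    rw [this]

/-- **THE CLASS NORMAL FORM.**  `y` perfect; a flat block `[a, a+m)` with frozen outside bits `ρ`; `Q` any set of cuts OUTSIDE the block; a residue
class `τ` and a reference input `v₀` of the class at which `g₀ ∈ Q` is live.  Split `Q ∖ {g₀}` by liveness at `v₀` into `Qd` (dead) and `Ql` (live).
Then at EVERY input of the class the normal form `mergeSet (silenceSet y Qd) g₀ Ql` — dead members silenced, live members merged into `g₀`, all other
registers unchanged — wins.  (For `Q` = the quadratic cuts this is ONE exceptional register reading the live quadratics, rest `k`-form.) -/
theorem winsOn_class_normalForm {m : ℕ} (c : ℕ) (y : Fin (n + 1) → (Fin n → Bool) → Bool) (hperf : ∀ u, ringWinU c y u = true)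
    (ρ : Fin n → Bool) (a : ℕ) (h : a + m ≤ n) (Q : Finset (Fin (n + 1))) (hQ : ∀ g ∈ Q, g.val ≤ a ∨ a + m ≤ g.val)
    (g₀ : Fin (n + 1)) (hg₀ : g₀ ∈ Q) (τ : ℕ) (v₀ : Fin m → Bool) (hv₀ : (univ.filter fun j => v₀ j = true).card % 3 = τ % 3)
    (hlive₀ : liveCut c (fill ρ (blockEmb a m h) v₀) g₀ = true) (v : Fin m → Bool)
    (hv : (univ.filter fun j => v j = true).card % 3 = τ % 3) :
    ringWinU c (mergeSet (silenceSet y (Q.filter fun g => liveCut c (fill ρ (blockEmb a m h) v₀) g = false)) g₀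
        ((Q.filter fun g => liveCut c (fill ρ (blockEmb a m h) v₀) g = true).erase g₀)) (fill ρ (blockEmb a m h) v) = true := by
  rw [ringWinU_normalForm c y g₀ _ _ (notMem_erase g₀ _) (fill ρ (blockEmb a m h) v)]
  · exact hperf _
  · intro g hg
    rw [mem_filter] at hg
    rw [liveCut_fill_block_outside c ρ a h g (hQ g hg.1) v v₀ (by rw [hv, hv₀])]
    exact hg.2
  · intro g hg
    rw [mem_erase, mem_filter] at hg
    rw [liveCut_fill_block_outside c ρ a h g (hQ g hg.2.1) v v₀ (by rw [hv, hv₀]),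
      liveCut_fill_block_outside c ρ a h g₀ (hQ g₀ hg₀) v v₀ (by rw [hv, hv₀]), hlive₀]
    exact hg.2.2.symm

/-- **loss transfer:** a loss of the class normal form at an input of the class is a loss of `y` -/
theorem loss_of_class_normalForm_loss {m : ℕ} (c : ℕ) (y : Fin (n + 1) → (Fin n → Bool) → Bool)
    (ρ : Fin n → Bool) (a : ℕ) (h : a + m ≤ n) (Q : Finset (Fin (n + 1))) (hQ : ∀ g ∈ Q, g.val ≤ a ∨ a + m ≤ g.val)
    (g₀ : Fin (n + 1)) (hg₀ : g₀ ∈ Q) (τ : ℕ) (v₀ : Fin m → Bool) (hv₀ : (univ.filter fun j => v₀ j = true).card % 3 = τ % 3)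
    (hlive₀ : liveCut c (fill ρ (blockEmb a m h) v₀) g₀ = true)
    (hloss : ∃ v : Fin m → Bool, (univ.filter fun j => v j = true).card % 3 = τ % 3 ∧
      ringWinU c (mergeSet (silenceSet y (Q.filter fun g => liveCut c (fill ρ (blockEmb a m h) v₀) g = false)) g₀
        ((Q.filter fun g => liveCut c (fill ρ (blockEmb a m h) v₀) g = true).erase g₀)) (fill ρ (blockEmb a m h) v) = false) :
    ∃ u, ringWinU c y u = false := by
  by_contra hno
  push Not at hno
  have hperf : ∀ u, ringWinU c y u = true := fun u => by
    cases hu : ringWinU c y u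
    · exact absurd hu (hno u)
    · rfl
  obtain ⟨v, hv, hl⟩ := hloss
  rw [winsOn_class_normalForm c y hperf ρ a h Q hQ g₀ hg₀ τ v₀ hv₀ hlive₀ v hv] at hl
  exact Bool.noConfusion hl

/-- shape of the class normal form: the registers of `Q ∖ {g₀}` are constantly `false` (so `k`-form for every `k`), every register outside `Q` is
unchanged, and `g₀` reads `y g₀ ⊕ ⨁_{g ∈ Q live, g ≠ g₀} y g` -/
theorem classNormalForm_of_not_mem (y : Fin (n + 1) → (Fin n → Bool) → Bool) {g₀ g : Fin (n + 1)} {Qd Ql : Finset (Fin (n + 1))}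
    (hd : g ∉ Qd) (hl : g ∉ Ql) (h₀ : g ≠ g₀) (u : Fin n → Bool) : mergeSet (silenceSet y Qd) g₀ Ql g u = y g u := by
  rw [mergeSet_of_not_mem _ hl h₀, silenceSet_of_not_mem _ hd]

/-- shape of the class normal form on the exceptional set -/
theorem classNormalForm_of_mem (y : Fin (n + 1) → (Fin n → Bool) → Bool) {g₀ g : Fin (n + 1)} {Qd Ql : Finset (Fin (n + 1))}
    (hmem : g ∈ Qd ∨ g ∈ Ql) (h₀ : g ≠ g₀) (u : Fin n → Bool) : mergeSet (silenceSet y Qd) g₀ Ql g u = false := by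
  rcases hmem with hm | hm
  · by_cases hl : g ∈ Ql
    · exact mergeSet_of_mem _ hl h₀ u
    · rw [mergeSet_of_not_mem _ hl h₀, silenceSet_of_mem _ hm]
  · exact mergeSet_of_mem _ hm h₀ u

/-- the exceptional register of the class normal form reads `y g₀ ⊕ ⨁_{g ∈ Ql} y g` (when `g₀ ∉ Qd` and `Ql`, `Qd` are disjoint) -/
theorem classNormalForm_self (y : Fin (n + 1) → (Fin n → Bool) → Bool) {g₀ : Fin (n + 1)} {Qd Ql : Finset (Fin (n + 1))}
    (h₀ : g₀ ∉ Qd) (hdl : ∀ g ∈ Ql, g ∉ Qd) (u : Fin n → Bool) :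
    mergeSet (silenceSet y Qd) g₀ Ql g₀ u = xor (y g₀ u) (decide ((Ql.filter fun g => y g u = true).card % 2 = 1)) := by
  have hf : (Ql.filter fun g' => silenceSet y Qd g' u = true) = Ql.filter fun g => y g u = true :=
    filter_congr fun g hg => by rw [silenceSet_of_not_mem _ (hdl g hg)]
  rw [mergeSet_self, silenceSet_of_not_mem _ h₀, hf]

end Summit.QuantumAdvantage.QuantumAdvantage.Theorems.LivenessSeparation
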